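import Literature.NumberTheory.Automorphic.RestrictedTensorProductLift
import Literature.NumberTheory.Automorphic.RestrictedTensorProductProofs
import HarnessLib

/-!
# Restricted tensor products: transport along LOCAL equivalences
(Flath 1979, §2, Theorem 2 / Example 2 and the Remark following it)

Topic `NumberTheory/Automorphic`; namespace `Literature.NumberTheory.Automorphic` (the home of the tree's
`IsRestrictedTensorProductRep`).  Theorems only (no definition, no named fact, no `sorry`).

The tree proves the UNIQUENESS halves of Flath's functoriality: a global isomorphism of restricted tensor products
forces isomorphic local factors (`IsRestrictedTensorProductRep.nonempty_equiv`), two restricted tensor products of the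
SAME family with unit-proportional base vectors are isomorphic (`indep_of_base_vectors_holds`, `unique_holds`), and
`⊗'` is functorial in families of linear maps carrying base vectors to base vectors (`IsRestrictedTensorProduct.map`,
`map_apply`, `RestrictedTensorProductLift.lean`).  This file supplies the converse gluing used whenever local data are
only known UP TO ISOMORPHISM (Flath 1979, §2, Example 2: «if `σ_v : V_v → V_v'` are `G_v`-isomorphisms with
`σ_v(x_v°) = x_v'°` for almost all `v`, then `⊗σ_v` is a `G`-isomorphism `⊗'V_v → ⊗'V_v'`», and the Remark following it
on changing the base vectors by units):

* `RestrictedFamily.piMap_smul` — a family of intertwiners `A i : V i → V' i` (`A i ∘ ρ i g = ρ' i g ∘ A i`) carrying base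
  vectors to base vectors is equivariant for the coordinatewise actions of `Πʳ i, [G i, K i]` on restricted families;
* `IsRestrictedTensorProductRep.map_comp_eq` — hence `⊗' A i : W → W'` intertwines `π = ⊗' ρ i` and `π' = ⊗' ρ' i`;
* **`IsRestrictedTensorProductRep.exists_equiv_of_forall_equiv_of_eq`** — local EQUIVALENCES `e i : V i ≃ V' i`
  intertwining `ρ i`, `ρ' i` with `e i (x₀ i) = x₀' i` for almost all `i` glue to an equivariant `E : W ≃ₗ[k] W'` with
  `E (j x) = j' (e • x)`;
* **`IsRestrictedTensorProductRep.exists_equiv_of_forall_equiv`** — the same when `x₀' i` is only a UNIT MULTIPLE of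
  `e i (x₀ i)` for almost all `i` (the situation of spherical representations with one-dimensional fixed lines), through
  the tree's rescaling transport `IsRestrictedTensorProductRep.comp_rescale`.

Everything over an arbitrary commutative ring `k`.  Consumer (cell hodgecm-mathlib, d6 line, census
`CENSUS-S1b-CaseB-relabel` row 6): a place-by-place isomorphism of local oscillator representations ([Liu2021, Lem. D.1 (4)])
glues to an isomorphism of the adèlic ones.  HC_CM is proved only modulo the 7 printed citations until rung 0 closes; this
file proves no cell binder.

## References
* [Flath1979] D. Flath, *Decomposition of representations into tensor products*, Proc. Sympos. Pure Math. 33 (Corvallis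
  1979), part 1, 179–183, §2: Theorem 2, Example 2 and the Remark following it.
* [Bump1997] D. Bump, *Automorphic forms and representations* (1997), §3.4.
-/

set_option autoImplicit false

open scoped RestrictedProduct
open Filter

namespace Literature.NumberTheory.Automorphic

universe u uk uG v v' w w'

variable {ι : Type u} {k : Type uk} [CommRing k] {G : ι → Type uG} [∀ i, Group (G i)] {K : ∀ i, Subgroup (G i)}
  {V : ι → Type v} [∀ i, AddCommGroup (V i)] [∀ i, Module k (V i)]
  {V' : ι → Type v'} [∀ i, AddCommGroup (V' i)] [∀ i, Module k (V' i)]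
  {ρ : ∀ i, Representation k (G i) (V i)} {ρ' : ∀ i, Representation k (G i) (V' i)}
  {x₀ : ∀ i, V i} {x₀' : ∀ i, V' i}

/-- **A family of intertwiners is equivariant on restricted families**: if `A i ∘ ρ i g = ρ' i g ∘ A i` for all `i`
and `A i (x₀ i) = x₀' i` for almost all `i`, then `A • (g • x) = g • (A • x)` for the coordinatewise actions of
`Πʳ i, [G i, K i]`. [cite: Flath1979, §2 Example 2] -/
theorem RestrictedFamily.piMap_smul (A : ∀ i, V i →ₗ[k] V' i) (hA : ∀ᶠ i in cofinite, A i (x₀ i) = x₀' i)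
    (hAρ : ∀ i (g : G i) (v : V i), A i (ρ i g v) = ρ' i g (A i v))
    (hx₀ : ∀ᶠ i in cofinite, x₀ i ∈ (ρ i).fixedPoints (K i))
    (hx₀' : ∀ᶠ i in cofinite, x₀' i ∈ (ρ' i).fixedPoints (K i))
    (g : Πʳ i, [G i, K i]) (x : RestrictedFamily V x₀) :
    RestrictedFamily.piMap A hA (RestrictedFamily.smul ρ hx₀ g x) =
      RestrictedFamily.smul ρ' hx₀' g (RestrictedFamily.piMap A hA x) := by
  ext i
  simp [hAρ]

variable [DecidableEq ι] {W : Type w} [AddCommGroup W] [Module k W] {W' : Type w'} [AddCommGroup W'] [Module k W']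
  {π : Representation k (Πʳ i, [G i, K i]) W} {π' : Representation k (Πʳ i, [G i, K i]) W'}
  {hx₀ : ∀ᶠ i in cofinite, x₀ i ∈ (ρ i).fixedPoints (K i)}
  {hx₀' : ∀ᶠ i in cofinite, x₀' i ∈ (ρ' i).fixedPoints (K i)}
  {j : RestrictedFamily V x₀ → W} {j' : RestrictedFamily V' x₀' → W'} {S₀ S₀' : Finset ι}

/-- **`⊗' A i` is an intertwiner**: for restricted tensor products `(W, π, j) = ⊗' (ρ i, x₀ i)` and
`(W', π', j') = ⊗' (ρ' i, x₀' i)` and intertwiners `A i` carrying base vectors to base vectors (a.e.), the induced map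
`⊗' A i = h.map … : W → W'` satisfies `(⊗' A) ∘ π g = π' g ∘ (⊗' A)` (checked on the spanning vectors `j x`).
[cite: Flath1979, §2 Example 2] -/
theorem IsRestrictedTensorProductRep.map_comp_eq (h : IsRestrictedTensorProductRep ρ π hx₀ j S₀)
    (h' : IsRestrictedTensorProductRep ρ' π' hx₀' j' S₀') (A : ∀ i, V i →ₗ[k] V' i)
    (hA : ∀ᶠ i in cofinite, A i (x₀ i) = x₀' i) (hAρ : ∀ i (g : G i) (v : V i), A i (ρ i g v) = ρ' i g (A i v))
    (g : Πʳ i, [G i, K i]) :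
    h.isRestrictedTensorProduct.map h'.isRestrictedTensorProduct.isRestrictedMultilinear A hA ∘ₗ π g =
      π' g ∘ₗ h.isRestrictedTensorProduct.map h'.isRestrictedTensorProduct.isRestrictedMultilinear A hA := by
  refine h.isRestrictedTensorProduct.linearMap_ext fun x => ?_
  rw [LinearMap.comp_apply, LinearMap.comp_apply, ← h.map_smul, IsRestrictedTensorProduct.map_apply,
    IsRestrictedTensorProduct.map_apply, RestrictedFamily.piMap_smul A hA hAρ hx₀ hx₀', h'.map_smul]

/-- **Gluing local equivalences, exact base vectors** (Flath 1979, §2, Example 2): if `(W, π, j) = ⊗' (ρ i, x₀ i)` and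
`(W', π', j') = ⊗' (ρ' i, x₀' i)` are restricted tensor products and `e i : V i ≃ V' i` are equivalences of the local
representations with `e i (x₀ i) = x₀' i` for almost all `i`, then there is an equivariant linear isomorphism
`E : W ≃ W'` with `E (j x) = j' (e • x)` — namely `⊗' e i`, with inverse `⊗' (e i)⁻¹`. [cite: Flath1979, §2 Example 2] -/
theorem IsRestrictedTensorProductRep.exists_equiv_of_forall_equiv_of_eq
    (h : IsRestrictedTensorProductRep ρ π hx₀ j S₀) (h' : IsRestrictedTensorProductRep ρ' π' hx₀' j' S₀')
    (e : ∀ i, V i ≃ₗ[k] V' i) (he : ∀ i (g : G i) (v : V i), e i (ρ i g v) = ρ' i g (e i v))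
    (hex : ∀ᶠ i in cofinite, e i (x₀ i) = x₀' i) :
    ∃ E : W ≃ₗ[k] W',
      (∀ x, E (j x) = j' (RestrictedFamily.piMap (fun i => (e i : V i →ₗ[k] V' i)) hex x)) ∧
        ∀ g : Πʳ i, [G i, K i], (E : W →ₗ[k] W') ∘ₗ π g = π' g ∘ₗ (E : W →ₗ[k] W') := by
  have hex' : ∀ᶠ i in cofinite, ((e i).symm : V' i →ₗ[k] V i) (x₀' i) = x₀ i :=
    hex.mono fun i hi => by rw [LinearEquiv.coe_coe, ← hi, LinearEquiv.symm_apply_apply]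
  let F : W →ₗ[k] W' :=
    h.isRestrictedTensorProduct.map h'.isRestrictedTensorProduct.isRestrictedMultilinear
      (fun i => (e i : V i →ₗ[k] V' i)) hex
  let F' : W' →ₗ[k] W :=
    h'.isRestrictedTensorProduct.map h.isRestrictedTensorProduct.isRestrictedMultilinear
      (fun i => ((e i).symm : V' i →ₗ[k] V i)) hex'
  have hF : ∀ x, F (j x) = j' (RestrictedFamily.piMap (fun i => (e i : V i →ₗ[k] V' i)) hex x) := fun x =>
    IsRestrictedTensorProduct.map_apply _ _ _ _ x
  have hF' : ∀ y, F' (j' y) = j (RestrictedFamily.piMap (fun i => ((e i).symm : V' i →ₗ[k] V i)) hex' y) := fun y =>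
    IsRestrictedTensorProduct.map_apply _ _ _ _ y
  have h₁ : F'.comp F = LinearMap.id := h.isRestrictedTensorProduct.linearMap_ext fun x => by
    rw [LinearMap.comp_apply, hF, hF', LinearMap.id_apply]
    congr 1
    ext i
    simp
  have h₂ : F.comp F' = LinearMap.id := h'.isRestrictedTensorProduct.linearMap_ext fun y => by
    rw [LinearMap.comp_apply, hF', hF, LinearMap.id_apply]
    congr 1
    ext i
    simp
  refine ⟨LinearEquiv.ofLinear F F' h₂ h₁, fun x => hF x, fun g => ?_⟩
  exact h.map_comp_eq h' (fun i => (e i : V i →ₗ[k] V' i)) hex (fun i g v => he i g v) g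

/-- **Gluing local equivalences, base vectors matched up to units** (Flath 1979, §2, Example 2 with the Remark
following it): if `(W, π, j) = ⊗' (ρ i, x₀ i)`, `(W', π', j') = ⊗' (ρ' i, x₀' i)`, the `e i : V i ≃ V' i` intertwine
`ρ i` and `ρ' i`, and `x₀' i = c i • e i (x₀ i)` with units `c i` for almost all `i` (e.g. both base vectors span the
same one-dimensional `K i`-fixed line), then `π ≅ π'` equivariantly.  Proof: re-base `(W', π', j')` at
`x₀'' i := e i (x₀ i)` by the tree's rescaling transport (`comp_rescale`), then glue exactly
(`exists_equiv_of_forall_equiv_of_eq`). [cite: Flath1979, §2 Remark following Example 2] -/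
theorem IsRestrictedTensorProductRep.exists_equiv_of_forall_equiv
    (h : IsRestrictedTensorProductRep ρ π hx₀ j S₀) (h' : IsRestrictedTensorProductRep ρ' π' hx₀' j' S₀')
    (e : ∀ i, V i ≃ₗ[k] V' i) (he : ∀ i (g : G i) (v : V i), e i (ρ i g v) = ρ' i g (e i v))
    (hc : ∀ᶠ i in cofinite, ∃ c : kˣ, x₀' i = c • e i (x₀ i)) :
    ∃ E : W ≃ₗ[k] W', ∀ g : Πʳ i, [G i, K i], (E : W →ₗ[k] W') ∘ₗ π g = π' g ∘ₗ (E : W →ₗ[k] W') := by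
  classical
  -- the transported base vectors `x₀'' i := e i (x₀ i)` are `K i`-fixed a.e.
  have hx₀'' : ∀ᶠ i in cofinite, e i (x₀ i) ∈ (ρ' i).fixedPoints (K i) :=
    hx₀.mono fun i hi => ((ρ' i).mem_fixedPoints (K i) _).2 fun g hg => by
      rw [← he, ((ρ i).mem_fixedPoints (K i) _).1 hi g hg]
  -- choose the units and a rescaling map `Φ : RestrictedFamily V' (e • x₀) → RestrictedFamily V' x₀'`
  let c : ι → kˣ := fun i => if hi : ∃ c : kˣ, x₀' i = c • e i (x₀ i) then hi.choose else 1
  have hc' : ∀ᶠ i in cofinite, x₀' i = c i • e i (x₀ i) := hc.mono fun i hi => by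
    simp only [c, dif_pos hi]
    exact hi.choose_spec
  have hT : ∀ i ∉ (Filter.eventually_cofinite.1 hc').toFinset, x₀' i = c i • e i (x₀ i) := fun i hi => by
    by_contra hne
    exact hi (by simpa using hne)
  obtain ⟨Φ, hΦ⟩ := RestrictedFamily.exists_rescale (V := V') (x₀ := fun i => e i (x₀ i)) c hc'
  -- `(W', π', j' ∘ Φ)` is a restricted tensor product of the `ρ' i` with respect to `e • x₀`
  have h'' := h'.comp_rescale hΦ _ hT hx₀''
  obtain ⟨E, -, hE⟩ := h.exists_equiv_of_forall_equiv_of_eq h'' e he (Eventually.of_forall fun _ => rfl)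
  exact ⟨E, hE⟩

end Literature.NumberTheory.Automorphic
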